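import Literature.NumberTheory.Automorphic.UnitaryGroupBorelHeightContinuous
import Literature.NumberTheory.Automorphic.UnitaryGroupKernelDictionary
import Literature.NumberTheory.Automorphic.UnitaryGroupTruncationFiniteSum
import Literature.NumberTheory.Automorphic.UnitaryGroupBorelConstantTermInvariance
import Literature.MeasureTheory.Group.InvariantQuotientUnfolding
import Mathlib.Analysis.Normed.Module.FiniteDimension
import HarnessLib

/-!
# Arthur's truncated kernel `k^T` on `U(3)` is a Borel function, on `G(𝔸_F)` and on `G(F)\G(𝔸_F)`
(Rogawski, *Automorphic Representations of Unitary Groups in Three Variables* (1990), §2.2, p. 13: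
«For `T` sufficiently regular, `k^T(x)` is integrable over `𝐙G\𝐆`» — here the measurability half;
Gelbart, *Automorphic Forms on Adele Groups* (1975), (9.20))

Topic `NumberTheory/Automorphic`; namespace `Literature.NumberTheory.Automorphic.UnitaryGroup`. THEOREMS
ONLY over accepted tree modules: no definition, no named fact, no `sorry`, no instance, no notation.

For `f ∈ C_c(G(𝔸_F))`, a Haar measure `ν` of `N(𝔸_F)`, a fundamental domain `𝓕` of `N(F)` and
`T > 0`, the truncated kernel `k^T = K(x, x) − Σ_δ 1_{H(δx) > T} K_B(δx, δx)` of
★ `UnitaryGroupArthurTruncatedKernel` is Borel measurable on `U(J₃)(𝔸_F)`, and so is its descent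
`[g] ↦ k^T(g⁻¹)` to the automorphic quotient — the MEASURABILITY HALF of the named fact
★ `TruncatedKernelIntegrable` (which is thereby a statement about the size of `k^T` only):

* §1 `continuous_borelSum` — `(x, z) ↦ Σ_{β ∈ B(F)} f(x⁻¹ β z)` is jointly continuous (every `N`;
  ★ `continuous_integral_comp_mul_inv_mul_inv` for the counting measure on the closed discrete
  image of `B(F)` in `G(𝔸_F)`, as for ★ `continuous_kernel`);
* §2 `stronglyMeasurable_kernelBorel_diag` — `y ↦ K_B(y, y) = ν(𝓕)⁻¹ ∫_𝓕 Σ_β f(y⁻¹ β u y) dν(u)` is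
  (strongly) measurable (every `N`; a parametric Bochner integral of a jointly continuous integrand,
  Mathlib `StronglyMeasurable.integral_prod_left`); `measurable_kernelBorelTail` — the cut-off
  `1_{H > T} K_B(y, y)` is measurable (`{H > T}` is open, ★ `isOpen_setOf_lt_borelHeight`);
* §3 (`N = 3`, `T > 0`) `measurable_pseudoEisenstein_kernelBorelTail` — `x ↦ Σ_δ 1_{H(δx)>T} K_B(δx,δx)`
  is measurable (for each `x` the `finsum` is a finite sum, ★ `finite_support_kernelBorelTail_translate`,
  hence a `tsum` over the countable `B(F)\G(F)`, Mathlib `Measurable.tsum`);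
  **`measurable_truncatedKernel`**; **`measurable_quotFun_truncatedKernel`** — the descended `k^T` on
  `G(𝔸_F) ⧸ G(F)` is Borel (★ `measurable_quotient_iff`: Borel measurability descends along the
  quotient by the closed `G(F)`), and `aestronglyMeasurable_quotFun_truncatedKernel`.

## References

* J. D. Rogawski, *Automorphic Representations of Unitary Groups in Three Variables*, Annals of
  Mathematics Studies 123 (1990), §2.2 (p. 13) [Rogawski1990].
* S. Gelbart, *Automorphic Forms on Adele Groups* (1975), §9 (9.20) [Gelbart1975].
-/

noncomputable section

open MeasureTheory Measure NumberField IsDedekindDomain Topology Set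
open scoped NNReal ENNReal MatrixGroups

namespace Literature.NumberTheory.Automorphic

namespace UnitaryGroup

variable {F E : Type} [Field F] [NumberField F] [Field E] [NumberField E] [Algebra F E]
  {c : E ≃ₐ[F] E} {N : ℕ}

/-- `∫ h dcount = Σ' h` for `ℂ`-valued functions on a countable space with measurable singletons
(private plumbing, as in `UnitaryGroupKernelDictionary`). [folklore] -/
private theorem integral_count_eq_tsum'' {ι : Type*} [MeasurableSpace ι] [MeasurableSingletonClass ι]
    [Countable ι] (g : ι → ℂ) : ∫ i, g i ∂(Measure.count : Measure ι) = ∑' i, g i := by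
  by_cases hs : Summable g
  · have hint : Integrable g (Measure.count : Measure ι) :=
      integrable_count_iff.2 (summable_norm_iff.2 hs)
    rw [integral_countable hint]
    refine tsum_congr fun i => ?_
    rw [measureReal_def, Measure.count_singleton, ENNReal.toReal_one, one_smul]
  · have hint : ¬Integrable g (Measure.count : Measure ι) := fun h =>
      hs (summable_norm_iff.1 (integrable_count_iff.1 h))
    rw [integral_undef hint, tsum_eq_zero_of_not_summable hs]

/-- `𝔸_E` is Hausdorff (local copy of the standard three-line argument). [folklore] -/
private theorem t2Space_adeleRing_E₆ : T2Space (AdeleRing (𝓞 E) E) := by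
  haveI : T2Space (FiniteAdeleRing (𝓞 E) E) := inferInstanceAs <| T2Space
    (RestrictedProduct (fun w : HeightOneSpectrum (𝓞 E) => w.adicCompletion E)
      (fun w => (w.adicCompletionIntegers E : Set (w.adicCompletion E))) Filter.cofinite)
  haveI : T2Space (InfiniteAdeleRing E) :=
    inferInstanceAs <| T2Space ((w : InfinitePlace E) → w.Completion)
  exact inferInstanceAs <| T2Space (InfiniteAdeleRing E × FiniteAdeleRing (𝓞 E) E)

/-! ## §1 The Borel sum is jointly continuous -/

section BorelSum

variable [MeasurableSpace (quasiSplit F E c N).Adelic] [BorelSpace (quasiSplit F E c N).Adelic]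

/-- **`(x, z) ↦ Σ_{β ∈ B(F)} f(x⁻¹ β z)` is jointly continuous** for `f ∈ C_c(G(𝔸_F))`: the image
`B(F) ≤ G(𝔸_F)` of the rational Borel is a discrete closed subgroup, the sum is the integral of
`h ↦ f(x⁻¹ h z)` against its counting measure, and ★ `continuous_integral_comp_mul_inv_mul_inv`
applies (locally the sum runs over a fixed finite set; Gelbart (1975), p. 120). Every `N`.
[cite: Gelbart1975, (9.20)] -/
theorem continuous_borelSum {f : (quasiSplit F E c N).Adelic → ℂ} (hf : Continuous f)
    (hfs : HasCompactSupport f) :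
    Continuous fun p : (quasiSplit F E c N).Adelic × (quasiSplit F E c N).Adelic => borelSum f p.1 p.2 := by
  haveI : DiscreteTopology ↥(quasiSplit F E c N).arithmeticSubgroup := isDiscreteRational_quasiSplit
  haveI := secondCountableTopology_adeleRing E
  haveI := locallyCompactSpace_adeleRing' E
  haveI : T2Space (quasiSplit F E c N).Adelic :=
    inferInstanceAs (T2Space (adelic F E c N ((StdForm.antidiagonal N).over E)))
  haveI : LocallyCompactSpace (quasiSplit F E c N).Adelic :=
    inferInstanceAs (LocallyCompactSpace (adelic F E c N ((StdForm.antidiagonal N).over E)))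
  haveI : SecondCountableTopology (quasiSplit F E c N).Adelic :=
    inferInstanceAs (SecondCountableTopology (adelic F E c N ((StdForm.antidiagonal N).over E)))
  -- the image `B ≤ G(𝔸_F)` of `B(F)`
  let ι : ↥(quasiSplit F E c N).arithmeticSubgroup →* (quasiSplit F E c N).Adelic :=
    (quasiSplit F E c N).arithmeticSubgroup.subtype
  let B : Subgroup (quasiSplit F E c N).Adelic := (arithmeticBorel F E c N).map ι
  have hBle : B ≤ (quasiSplit F E c N).arithmeticSubgroup := by
    rintro _ ⟨β, -, rfl⟩; exact β.2
  -- discrete, closed, countable; `count` finite on compacta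
  haveI : DiscreteTopology ↥B :=
    DiscreteTopology.of_continuous_injective
      (f := fun b : ↥B => (⟨(b : (quasiSplit F E c N).Adelic), hBle b.2⟩ :
        ↥(quasiSplit F E c N).arithmeticSubgroup))
      (continuous_subtype_val.subtype_mk _) (fun a b h => Subtype.ext
        (congrArg (fun z : ↥(quasiSplit F E c N).arithmeticSubgroup => (z : (quasiSplit F E c N).Adelic)) h))
  haveI : IsClosed ((B : Set (quasiSplit F E c N).Adelic)) := Subgroup.isClosed_of_discrete
  haveI : Countable ↥(quasiSplit F E c N).arithmeticSubgroup := by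
    rw [← quotientSubgroup_quasiSplit]; exact countable_quotientSubgroup_quasiSplit
  haveI : Countable ↥B := by
    have hinj : Function.Injective (fun b : ↥B => (⟨(b : (quasiSplit F E c N).Adelic), hBle b.2⟩ :
        ↥(quasiSplit F E c N).arithmeticSubgroup)) := fun a b h => Subtype.ext
      (congrArg (fun z : ↥(quasiSplit F E c N).arithmeticSubgroup => (z : (quasiSplit F E c N).Adelic)) h)
    exact hinj.countable
  haveI : IsFiniteMeasureOnCompacts (Measure.count : Measure ↥B) :=
    ⟨fun K hK => Measure.count_apply_lt_top.2 hK.finite_of_discrete⟩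
  -- the parametric integral is continuous
  have h := continuous_integral_comp_mul_inv_mul_inv B (Measure.count : Measure ↥B) (𝕜 := ℂ) hf hfs
  have hinv : Continuous fun p : (quasiSplit F E c N).Adelic × (quasiSplit F E c N).Adelic => (p.1⁻¹, p.2⁻¹) :=
    (continuous_inv.comp continuous_fst).prodMk (continuous_inv.comp continuous_snd)
  refine (h.comp hinv).congr fun p => ?_
  -- identify the integral with the Borel sum
  simp only [Function.comp_apply, inv_inv]
  rw [integral_count_eq_tsum'', borelSum_def]
  -- re-index `B ≃ arithmeticBorel` and `β ↦ β⁻¹`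
  let e : ↥(arithmeticBorel F E c N) ≃ ↥B :=
    ((arithmeticBorel F E c N).equivMapOfInjective ι Subtype.val_injective).toEquiv
  rw [← e.tsum_eq, ← (Equiv.inv ↥(arithmeticBorel F E c N)).tsum_eq]
  refine tsum_congr fun β => ?_
  simp only [Equiv.inv_apply]
  change f (p.1⁻¹ * (((((arithmeticBorel F E c N).equivMapOfInjective ι Subtype.val_injective) β⁻¹ : ↥B) :
      (quasiSplit F E c N).Adelic))⁻¹ * (p.2⁻¹)⁻¹) = _
  rw [Subgroup.coe_equivMapOfInjective_apply, inv_inv]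
  change f (p.1⁻¹ * ((((β⁻¹ : ↥(arithmeticBorel F E c N)) : (quasiSplit F E c N).arithmeticSubgroup) :
      (quasiSplit F E c N).Adelic))⁻¹ * p.2) = _
  rw [Subgroup.coe_inv, Subgroup.coe_inv, inv_inv]

end BorelSum

/-! ## §2 The Borel-kernel diagonal `y ↦ K_B(y, y)` and its cut-off are measurable (every `N`) -/

section BorelKernel

variable [MeasurableSpace (quasiSplit F E c N).Adelic] [BorelSpace (quasiSplit F E c N).Adelic]
  [MeasurableSpace (adelicUnipotent F E c N)] [BorelSpace (adelicUnipotent F E c N)]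

/-- **`y ↦ K_B(y, y)` is (strongly) measurable**: `K_B(y, y) = ν(𝓕)⁻¹ ∫_𝓕 Σ_β f(y⁻¹ β u y) dν(u)`
is a parametric Bochner integral (against the s-finite `ν|_𝓕`) of the jointly continuous integrand
`(u, y) ↦ Σ_β f(y⁻¹ β (u y))` (`continuous_borelSum`), Mathlib
`StronglyMeasurable.integral_prod_left`. Every `N`, every measure `ν` that is s-finite, every `𝓕`.
[cite: Rogawski1990, §2.2 (p. 13)] -/
theorem stronglyMeasurable_kernelBorel_diag {f : (quasiSplit F E c N).Adelic → ℂ} (hf : Continuous f)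
    (hfs : HasCompactSupport f) (ν : Measure (adelicUnipotent F E c N)) [SFinite ν]
    (𝓕 : Set (adelicUnipotent F E c N)) :
    StronglyMeasurable fun y : (quasiSplit F E c N).Adelic => kernelBorel ν 𝓕 f y y := by
  haveI := secondCountableTopology_adeleRing E
  haveI := locallyCompactSpace_adeleRing' E
  haveI : SecondCountableTopology (quasiSplit F E c N).Adelic :=
    inferInstanceAs (SecondCountableTopology (adelic F E c N ((StdForm.antidiagonal N).over E)))
  haveI : SecondCountableTopology (adelicUnipotent F E c N) :=
    TopologicalSpace.Subtype.secondCountableTopology _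
  -- the integrand `(u, y) ↦ borelSum f y (u y)` is jointly continuous
  have h1 : Continuous fun q : adelicUnipotent F E c N × (quasiSplit F E c N).Adelic =>
      (q.2, (q.1 : (quasiSplit F E c N).Adelic) * q.2) :=
    continuous_snd.prodMk ((continuous_subtype_val.comp continuous_fst).mul continuous_snd)
  have hF : Continuous ((fun p : (quasiSplit F E c N).Adelic × (quasiSplit F E c N).Adelic => borelSum f p.1 p.2) ∘
      fun q : adelicUnipotent F E c N × (quasiSplit F E c N).Adelic =>
        (q.2, (q.1 : (quasiSplit F E c N).Adelic) * q.2)) :=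
    Continuous.comp (continuous_borelSum hf hfs) h1
  have h := MeasureTheory.StronglyMeasurable.integral_prod_left' (μ := ν.restrict 𝓕) hF.stronglyMeasurable
  -- `h : StronglyMeasurable fun y => ∫ u, borelSum f y (u y) ∂(ν|_𝓕)`; `K_B(y, y)` is `ν(𝓕)⁻¹ •` that
  have heq : (fun y : (quasiSplit F E c N).Adelic => kernelBorel ν 𝓕 f y y) =
      fun y => ((ν 𝓕).toReal⁻¹ : ℝ) • (fun y' : (quasiSplit F E c N).Adelic => ∫ u,
        ((fun p : (quasiSplit F E c N).Adelic × (quasiSplit F E c N).Adelic => borelSum f p.1 p.2) ∘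
          fun q : adelicUnipotent F E c N × (quasiSplit F E c N).Adelic =>
            (q.2, (q.1 : (quasiSplit F E c N).Adelic) * q.2)) (u, y') ∂(ν.restrict 𝓕)) y :=
    funext fun y => kernelBorel_eq_smul_integral ν 𝓕 f y y
  rw [heq]
  exact h.const_smul ((ν 𝓕).toReal⁻¹ : ℝ)

/-- `y ↦ K_B(y, y)` is measurable. [cite: Rogawski1990, §2.2 (p. 13)] -/
theorem measurable_kernelBorel_diag {f : (quasiSplit F E c N).Adelic → ℂ} (hf : Continuous f)
    (hfs : HasCompactSupport f) (ν : Measure (adelicUnipotent F E c N)) [SFinite ν]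
    (𝓕 : Set (adelicUnipotent F E c N)) :
    Measurable fun y : (quasiSplit F E c N).Adelic => kernelBorel ν 𝓕 f y y :=
  (stronglyMeasurable_kernelBorel_diag hf hfs ν 𝓕).measurable

variable [NeZero N]

/-- **The cut-off Borel diagonal `1_{H > T} K_B(y, y)` is measurable** (`{H > T}` is open,
★ `isOpen_setOf_lt_borelHeight`). [cite: Rogawski1990, §2.2 (p. 13)] -/
theorem measurable_kernelBorelTail {f : (quasiSplit F E c N).Adelic → ℂ} (hf : Continuous f)
    (hfs : HasCompactSupport f) (ν : Measure (adelicUnipotent F E c N)) [SFinite ν]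
    (𝓕 : Set (adelicUnipotent F E c N)) (T : ℝ≥0) :
    Measurable (kernelBorelTail ν 𝓕 T f) :=
  (measurable_kernelBorel_diag hf hfs ν 𝓕).indicator (measurableSet_setOf_lt_borelHeight T)

end BorelKernel

/-! ## §3 `k^T` is Borel on `U(3)(𝔸_F)` and on the automorphic quotient -/

section Three

variable [MeasurableSpace (quasiSplit F E c 3).Adelic] [BorelSpace (quasiSplit F E c 3).Adelic]
  [MeasurableSpace (adelicUnipotent F E c 3)] [BorelSpace (adelicUnipotent F E c 3)]

/-- **The `δ`-sum `x ↦ Σ_δ 1_{H(δx) > T} K_B(δx, δx)` is measurable** (`T > 0`): pointwise a finite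
sum (★ `finite_support_kernelBorelTail_translate`), hence the `tsum` over the countable
`B(F)\G(F)` of the measurable `x ↦ 1_{H > T} K_B(δ x, δ x)` (Mathlib `Measurable.tsum`).
[cite: Rogawski1990, §2.2 (p. 13)] -/
theorem measurable_pseudoEisenstein_kernelBorelTail {f : (quasiSplit F E c 3).Adelic → ℂ}
    (hf : Continuous f) (hfs : HasCompactSupport f) (ν : Measure (adelicUnipotent F E c 3)) [SFinite ν]
    (𝓕 : Set (adelicUnipotent F E c 3)) {T : ℝ≥0} (hT : 0 < T) :
    Measurable fun x : (quasiSplit F E c 3).Adelic => pseudoEisenstein (kernelBorelTail ν 𝓕 T f) x := by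
  -- `B(F)\G(F)` is countable
  haveI : Countable ↥(quasiSplit F E c 3).arithmeticSubgroup := by
    rw [← quotientSubgroup_quasiSplit]; exact countable_quotientSubgroup_quasiSplit
  haveI : Countable (Quotient (QuotientGroup.rightRel (arithmeticBorel F E c 3))) :=
    Quotient.countable
  have heq : (fun x : (quasiSplit F E c 3).Adelic => pseudoEisenstein (kernelBorelTail ν 𝓕 T f) x) =
      fun x => ∑' q : Quotient (QuotientGroup.rightRel (arithmeticBorel F E c 3)),
        kernelBorelTail ν 𝓕 T f
          (((q.out : (quasiSplit F E c 3).arithmeticSubgroup) : (quasiSplit F E c 3).Adelic) * x) := by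
    funext x
    rw [pseudoEisenstein_def]
    exact (tsum_eq_finsum (finite_support_kernelBorelTail_translate ν 𝓕 hT f x)).symm
  rw [heq]
  refine Measurable.tsum fun q => ?_
  exact (measurable_kernelBorelTail hf hfs ν 𝓕 T).comp (measurable_const_mul _)

/-- **Arthur's truncated kernel `k^T` is Borel measurable on `U(3)(𝔸_F)`** for `f ∈ C_c`, `T > 0`,
every s-finite measure `ν` and every set `𝓕` (★ `continuous_kernel` for the diagonal `K(x, x)`, §§1–3
for the `δ`-sum) — the measurability half of ★ `TruncatedKernelIntegrable`.
[cite: Rogawski1990, §2.2 (p. 13)] -/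
theorem measurable_truncatedKernel {f : (quasiSplit F E c 3).Adelic → ℂ} (hf : Continuous f)
    (hfs : HasCompactSupport f) (ν : Measure (adelicUnipotent F E c 3)) [SFinite ν]
    (𝓕 : Set (adelicUnipotent F E c 3)) {T : ℝ≥0} (hT : 0 < T) :
    Measurable (truncatedKernel ν 𝓕 T f) := by
  have h1 : Measurable fun x : (quasiSplit F E c 3).Adelic => kernel f x x :=
    ((continuous_kernel hf hfs).comp (continuous_id.prodMk continuous_id)).measurable
  have h2 := measurable_pseudoEisenstein_kernelBorelTail hf hfs ν 𝓕 hT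
  have heq : truncatedKernel ν 𝓕 T f = fun x => kernel f x x - pseudoEisenstein (kernelBorelTail ν 𝓕 T f) x :=
    funext fun x => truncatedKernel_def ν 𝓕 T f x
  rw [heq]
  exact h1.sub h2

/-- **The descended truncated kernel `[g] ↦ k^T(g⁻¹)` is Borel on the automorphic quotient
`G(𝔸_F) ⧸ G(F)`**: Borel measurability descends along the quotient by the CLOSED subgroup
`A_G · G(F) = G(F)` (★ `measurable_quotient_iff`, ★ `isClosed_quotientSubgroup_quasiSplit`), and
`quotFun k^T ∘ π = k^T ∘ inv` (★ `quotFun_truncatedKernel_toAutomorphicQuotient'`) is measurable.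
[cite: Rogawski1990, §2.2 (p. 13)] -/
theorem measurable_quotFun_truncatedKernel {f : (quasiSplit F E c 3).Adelic → ℂ} (hf : Continuous f)
    (hfs : HasCompactSupport f) (ν : Measure (adelicUnipotent F E c 3)) [ν.IsHaarMeasure]
    {𝓕 : Set (adelicUnipotent F E c 3)} (h𝓕 : IsFundamentalDomain (rationalUnipotent F E c 3) 𝓕 ν)
    {T : ℝ≥0} (hT : 0 < T) :
    Measurable ((quasiSplit F E c 3).quotFun (truncatedKernel ν 𝓕 T f)) := by
  haveI := secondCountableTopology_adeleRing E
  haveI := locallyCompactSpace_adeleRing' E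
  haveI : T2Space (quasiSplit F E c 3).Adelic :=
    inferInstanceAs (T2Space (adelic F E c 3 ((StdForm.antidiagonal 3).over E)))
  haveI : LocallyCompactSpace (quasiSplit F E c 3).Adelic :=
    inferInstanceAs (LocallyCompactSpace (adelic F E c 3 ((StdForm.antidiagonal 3).over E)))
  haveI : SecondCountableTopology (quasiSplit F E c 3).Adelic :=
    inferInstanceAs (SecondCountableTopology (adelic F E c 3 ((StdForm.antidiagonal 3).over E)))
  -- `N(𝔸_F)` is second countable locally compact, so `ν` is s-finite
  haveI : T2Space (AdeleRing (𝓞 E) E) := t2Space_adeleRing_E₆ (E := E)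
  haveI : LocallyCompactSpace (adelicUnipotent F E c 3) := by
    have hcl : IsClosed ((adelicUnipotent F E c 3 : Set (quasiSplit F E c 3).Adelic)) := by
      change IsClosed (⇑(adelicVal F E c 3 ((StdForm.antidiagonal 3).over E)) ⁻¹'
        ((upperUnitriangular (Fin 3) (AdeleRing (𝓞 E) E) : Subgroup (GL (Fin 3) (AdeleRing (𝓞 E) E))) :
          Set (GL (Fin 3) (AdeleRing (𝓞 E) E))))
      exact (isClosed_upperUnitriangular (R := AdeleRing (𝓞 E) E)).preimage continuous_subtype_val
    exact hcl.locallyCompactSpace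
  haveI : SecondCountableTopology (adelicUnipotent F E c 3) :=
    TopologicalSpace.Subtype.secondCountableTopology _
  letI : MeasurableSpace ((quasiSplit F E c 3).Adelic ⧸ (quasiSplit F E c 3).quotientSubgroup) :=
    (quasiSplit F E c 3).instMeasurableSpaceAutomorphicQuotient
  haveI : BorelSpace ((quasiSplit F E c 3).Adelic ⧸ (quasiSplit F E c 3).quotientSubgroup) :=
    (quasiSplit F E c 3).instBorelSpaceAutomorphicQuotient
  have hmeas := (Literature.MeasureTheory.Group.measurable_quotient_iff
    (G := (quasiSplit F E c 3).Adelic) (H := (quasiSplit F E c 3).quotientSubgroup)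
    isClosed_quotientSubgroup_quasiSplit
    (F := (quasiSplit F E c 3).quotFun (truncatedKernel ν 𝓕 T f))).2
  have heq : (quasiSplit F E c 3).quotFun (truncatedKernel ν 𝓕 T f) ∘
      (QuotientGroup.mk : (quasiSplit F E c 3).Adelic → (quasiSplit F E c 3).Adelic ⧸ (quasiSplit F E c 3).quotientSubgroup) =
        fun g => truncatedKernel ν 𝓕 T f g⁻¹ := by
    funext g
    exact quotFun_truncatedKernel_toAutomorphicQuotient' ν h𝓕 T f g
  exact hmeas (heq ▸ (measurable_truncatedKernel hf hfs ν 𝓕 hT).comp measurable_inv)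

/-- Hence the integrand of `J^T(f)` is a.e.-strongly measurable for every measure `μ` on the
automorphic quotient (the measurability half of ★ `TruncatedKernelIntegrable`; `ℂ` is second
countable). [cite: Rogawski1990, §2.2 (p. 13)] -/
theorem aestronglyMeasurable_quotFun_truncatedKernel {f : (quasiSplit F E c 3).Adelic → ℂ}
    (hf : Continuous f) (hfs : HasCompactSupport f) (ν : Measure (adelicUnipotent F E c 3))
    [ν.IsHaarMeasure] {𝓕 : Set (adelicUnipotent F E c 3)}
    (h𝓕 : IsFundamentalDomain (rationalUnipotent F E c 3) 𝓕 ν) {T : ℝ≥0} (hT : 0 < T)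
    (μ : Measure (quasiSplit F E c 3).automorphicQuotient) :
    AEStronglyMeasurable ((quasiSplit F E c 3).quotFun (truncatedKernel ν 𝓕 T f)) μ :=
  (measurable_quotFun_truncatedKernel hf hfs ν h𝓕 hT).aestronglyMeasurable

end Three

end UnitaryGroup

end Literature.NumberTheory.Automorphic
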